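import Literature.AlgebraicGeometry.Deformation.ObstructionCocycleTwoData
import HarnessLib

/-!
# The Čech obstruction class of a framed module does not depend on the datum

Setting of `Deformation/ObstructionCocycleTwoData.lean`: `j : Y ⟶ Z₀`, `i : Z₀ ⟶ Z₁` a first-order
thickening, `eI : i_* j_* 𝒪_Y ≅ 𝓘`, an `𝒪_{Z₀}`-module `F`, `E = j^*F`, and two framed lifting data
`(C₁, L₁)`, `(C₂, L₂)` for `F` whose opens `U¹_a`, `U²_b` have affine pairwise intersections
`U¹_a ∩ U²_b` (e.g. all affine on a separated `Z₁`) and whose base opens cover `Y`. Then the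
`Ext²(E, E)`-classes (`Cech.classOf` for the canonical exact augmentations of the two covers of `Y`,
`Modules/CechTheta.lean`) of the two obstruction cocycles `ω_k = toLocalFamily κ(c_k)` COINCIDE
(`classOf_obstruction_eq`): on the common refinement they differ by a coboundary
(`exists_restrictFamilyAlong_sub_eq_dFamily`), and Čech classes are invariant under refinement
along index maps (`Cech.classOf_eq_of_common_refinement`, `Modules/CechRefineAlong.lean`).

This is "one checks that the obstruction is independent of the choices made" in the proof of
Hartshorne, *Deformation Theory*, Thm. 7.1, for the class in Mathlib's `Ext`. Everything is proved;
no named facts.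

## References

* R. Hartshorne, *Deformation Theory*, GTM 257 (2010), §7, proof of Thm. 7.1. [Hartshorne2010]
* R. Hartshorne, *Algebraic Geometry*, GTM 52 (1977), III Lemma 4.4. [Hartshorne1977]
-/

noncomputable section

open CategoryTheory CategoryTheory.Abelian AlgebraicGeometry Opposite TopologicalSpace Limits

namespace Literature.AlgebraicGeometry.Deformation

open Literature.AlgebraicGeometry.Modules Literature.AlgebraicGeometry.Motives

universe u

variable {Y Z₀ Z₁ : Scheme.{u}} {j : Y ⟶ Z₀} {i : Z₀ ⟶ Z₁} {F : Z₀.Modules} {ι₁ ι₂ : Type u}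

namespace FrameCover

variable (C₁ : FrameCover i F ι₁) (C₂ : FrameCover i F ι₂)

/-- The base opens of the common refinement cover `Y` when those of both covers do. [folklore] -/
lemma iSup_baseOpen_commonOpen (h₁ : iSup (C₁.baseFraming j).U = ⊤) (h₂ : iSup (C₂.baseFraming j).U = ⊤) :
    (⨆ p : ι₁ × ι₂, baseOpen j i (C₁.U p.1 ⊓ C₂.U p.2)) = ⊤ := by
  refine top_le_iff.mp fun y _ => ?_
  have hy₁ : y ∈ iSup (C₁.baseFraming j).U := by rw [h₁]; exact Opens.mem_top y
  have hy₂ : y ∈ iSup (C₂.baseFraming j).U := by rw [h₂]; exact Opens.mem_top y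
  obtain ⟨a, ha⟩ := Opens.mem_iSup.mp hy₁
  obtain ⟨b, hb⟩ := Opens.mem_iSup.mp hy₂
  exact Opens.mem_iSup.mpr ⟨(a, b), ha, hb⟩

namespace Lifts

variable {C₁ C₂} (L₁ : C₁.Lifts) (L₂ : C₂.Lifts)
  (eI : (Scheme.Modules.pushforward i).obj ((Scheme.Modules.pushforward j).obj (unitModule Y)) ≅
    idealModule i)

/-- The cocycle condition of an obstruction cocycle (for use with `classOf_obstruction_eq`).
[folklore] -/
theorem dFamily_toLocalFamily_defectCochain {ι : Type u} {C : FrameCover i F ι} (L : C.Lifts) :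
    Cech.dFamily ((C.baseFraming j).toLocalFamily (L.defectCochain eI)) = 0 :=
  (C.baseFraming j).dFamily_toLocalFamily_eq_zero _ (L.D₂_defectCochain eI)

variable [IsFirstOrderThickening i] [HasExt.{u + 1} Y.Modules]

/-- **The obstruction class does not depend on the datum**: for two framed lifting data of `F` with
affine pairwise intersections `U¹_a ∩ U²_b` and base opens covering `Y`, the `Ext²(E, E)`-classes of
the two obstruction cocycles coincide. [cite: Hartshorne2010, §7 (proof of Thm. 7.1)]
[cite: Hartshorne1977, III Lemma 4.4] -/
theorem classOf_obstruction_eq (h₁ : iSup (C₁.baseFraming j).U = ⊤) (h₂ : iSup (C₂.baseFraming j).U = ⊤)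
    (hW : ∀ p : ι₁ × ι₂, IsAffineOpen (C₁.U p.1 ⊓ C₂.U p.2))
    (hω₁ : Cech.dFamily ((C₁.baseFraming j).toLocalFamily (L₁.defectCochain eI)) = 0)
    (hω₂ : Cech.dFamily ((C₂.baseFraming j).toLocalFamily (L₂.defectCochain eI)) = 0) :
    Cech.classOf (Cech.exactAugmentation (C₂.baseFraming j).U _ h₂)
        ((C₂.baseFraming j).toLocalFamily (L₂.defectCochain eI)) hω₂ =
      Cech.classOf (Cech.exactAugmentation (C₁.baseFraming j).U _ h₁)
        ((C₁.baseFraming j).toLocalFamily (L₁.defectCochain eI)) hω₁ := by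
  obtain ⟨β, hβ⟩ := exists_restrictFamilyAlong_sub_eq_dFamily L₁ L₂ eI hW
  exact Cech.classOf_eq_of_common_refinement (@Prod.fst ι₁ ι₂) (@Prod.snd ι₁ ι₂)
    (baseOpen_restrictAlong_le (@Prod.fst ι₁ ι₂) (commonOpen C₁ C₂) (commonOpen_le₁ C₁ C₂))
    (baseOpen_restrictAlong_le (@Prod.snd ι₁ ι₂) (commonOpen C₁ C₂) (commonOpen_le₂ C₁ C₂))
    h₁ h₂ (iSup_baseOpen_commonOpen C₁ C₂ h₁ h₂) _ _ hω₁ hω₂ β (sub_eq_iff_eq_add'.mp hβ)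

end Lifts

end FrameCover

end Literature.AlgebraicGeometry.Deformation

end
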